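import Mathlib
import HarnessLib
import Summits.NavierStokesRegularity.Statement
import Literature.Analysis.FluidPDE.ClassicalSolution
import Literature.Analysis.FluidPDE.LerayHopf
import Literature.Analysis.FluidPDE.SuitableWeak
import Literature.Analysis.FluidPDE.SelfSimilar
import Literature.Analysis.FluidPDE.WeakSolution
import Literature.Analysis.FluidPDE.VectorCalculus
import Literature.Analysis.FluidPDE.MildSolution
import Literature.Analysis.FluidPDE.NSWave0
import Literature.Analysis.UnboundedOperators.HeatKernel

/-!
# Route `SqueezeCycle` — the Assembly, frame form (item stmt-NavierStokesRegularity-13913)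

The assembly item of route `SqueezeCycle` (rev ≥ 2) is the route's deciding theorem `closes`, curried:

  `MustSqueeze → ExtremalElementExists → ExtremalBiaxialitySubcritical → SingularZoom → NoTypeII →
   NoBlowupToClay → NavierStokesRegularity`.

Design constraint (why this file does NOT import the route module
`Summits.NavierStokesRegularity.NavierStokesRegularity.Theses.SqueezeCycle`): when an item closes, the
gate re-renders the route file with `import <closing module>` and `theorem Assembly_holds : Assembly := …`;
a closing module that itself imports the route module cannot be imported there (import cycle — the rev-1
episode of this route: stmt-NavierStokesRegularity-11616 was proved by `Theorems/SqueezeCycleAssembly.lean`,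
which imports the route file, so its `Assembly_holds` link could not be materialised and the item was
re-filed as stmt-NavierStokesRegularity-13913). So the theorem below is stated with the six hypotheses
INLINED VERBATIM (the bodies of `MustSqueeze`, `ExtremalElementExists`, `ExtremalBiaxialitySubcritical`,
`SingularZoom`, `NoTypeII`, `NoBlowupToClay`, copied from the route file rev 3, in the same `open` context),
so that its type is, by `δ`-unfolding only, the route decl
`Summit.NavierStokesRegularity.NavierStokesRegularity.Theses.SqueezeCycle.Assembly`, and the route file can
import this module without a cycle (same device as `Theorems/BlowupAssembly.lean`).

The proof is pure logic, identical to the route's deciding theorem `closes`.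
Step 1 (the card's dichotomy): for `u` in the Type-I model class `𝒦_C` either the Leray-gauge middle
strain eigenvalue is `≤ 1/8` at every point — then `MustSqueeze` gives `u ≡ 0` — or some point violates
it; then `ExtremalElementExists` produces an extremal configuration `(u', m ≥ 1/8, (t₀, x₀))` and
`ExtremalBiaxialitySubcritical` gives `m < 1/8`, absurd. Hence the Liouville statement on `𝒦_C`
(`SqueezeLiouville`, inlined as an intermediate `have`).
Step 2 (shared tail of route ClockStretchingLaw): `NoBlowupToClay` reduces Clay (A) to continuation past
every `T`; a non-extendable finite-energy classical solution from a rapidly decaying datum is maximal,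
`NoTypeII` gives the Type-I rate, and `SingularZoom` needs only "no singular element of `𝒦_C`", which the
Liouville statement gives (a field vanishing on `t < 0` is bounded in every parabolic cylinder).
No analysis, no new definitions; the open content lives in the cruxes.
-/

namespace Summit.NavierStokesRegularity.NavierStokesRegularity.Theorems

open scoped BigOperators Topology Manifold Classical MeasureTheory ProbabilityTheory Matrix InnerProductSpace ComplexConjugate ContinuousMap
open Filter Set Function TopologicalSpace MeasureTheory

open Literature.NS

/-- **Assembly of route SqueezeCycle, frame form** (item stmt-NavierStokesRegularity-13913):
`MustSqueeze → ExtremalElementExists → ExtremalBiaxialitySubcritical → SingularZoom → NoTypeII →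
NoBlowupToClay → NavierStokesRegularity`, the six hypotheses written out verbatim (bodies of the route
decls, rev 3) so that this type unfolds to the route decl
`Summit.NavierStokesRegularity.NavierStokesRegularity.Theses.SqueezeCycle.Assembly` by `δ`-reduction
alone and the module need not import the route file. Proof = the route's deciding theorem `closes`:
dichotomy on the Leray-gauge middle strain eigenvalue (`Λ ≤ 1/8` everywhere ⇒ `MustSqueeze`; else an
extremal element with attained maximum `m ≥ 1/8` exists and `ExtremalBiaxialitySubcritical` forces
`m < 1/8`) gives Liouville on the Type-I model class `𝒦_C`; then `NoBlowupToClay`, `NoTypeII` and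
`SingularZoom` (fed "no singular element of `𝒦_C`", immediate from Liouville) give Clay (A). [folklore] -/
theorem squeezeCycle_assembly_frame_proof :
    (∀ (C : ℝ) (u : ℝ → EuclideanSpace ℝ (Fin 3) → EuclideanSpace ℝ (Fin 3)), ContDiffOn ℝ (⊤ : ℕ∞)
      (Function.uncurry u) (Set.Iio 0 ×ˢ Set.univ) ∧ (∀ t < 0,
      Literature.Analysis.FluidPDE.VectorCalculus.IsDivFree (u t)) ∧ (∀ s t : ℝ, s < t → t < 0 → ∀
      x, u t x = Literature.Analysis.FluidPDE.heatFlow (u s) (t-s) x - ∫ τ in Set.Ioo s t, ∫ y,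
      ((-(inner ℝ (x-y) (u τ y) / (2*(t-τ)) * Literature.Analysis.UnboundedOperators.heatKernel
      (t-τ) (x-y))) • u τ y + (∫ σ in Set.Ioi (t-τ),
      Literature.Analysis.UnboundedOperators.heatKernel σ (x-y) / (4*σ^2)) • (inner ℝ (x-y) (u τ y)
      • u τ y + inner ℝ (u τ y) (u τ y) • (x-y) + inner ℝ (x-y) (u τ y) • u τ y) - ((∫ σ in Set.Ioi
      (t-τ), Literature.Analysis.UnboundedOperators.heatKernel σ (x-y) / (8*σ^3)) * (inner ℝ (x-y)
      (u τ y) * inner ℝ (x-y) (u τ y))) • (x-y))) ∧ Literature.Analysis.FluidPDE.HasTypeITimeDecay C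
      u ∧ (∀ (x₀ : EuclideanSpace ℝ (Fin 3)) (t₀ r : ℝ), t₀ ≤ 0 → 0 < r → (∀ t, t₀ - r^2 < t → t <
      t₀ → r⁻¹ * ∫ x in Metric.ball x₀ r, ‖u t x‖^2 ≤ C) ∧ r⁻¹ * ∫ t in Set.Ioo (t₀ - r^2) t₀, ∫ x
      in Metric.ball x₀ r, ‖fderiv ℝ (u t) x‖^2 ≤ C) → (∀ t < 0, ∀ x, (∃ v w : EuclideanSpace ℝ (Fin
      3), ‖v‖ = 1 ∧ ‖w‖ = 1 ∧ inner ℝ v w = 0 ∧ ∀ α β : ℝ, (-t) * inner ℝ (fderiv ℝ (u t) x (α • v +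
      β • w)) (α • v + β • w) ≤ (1 / 8 : ℝ) * (α^2 + β^2))) → ∀ t < 0, ∀ x, u t x = 0) →
    (∀ (C : ℝ) (u : ℝ → EuclideanSpace ℝ (Fin 3) → EuclideanSpace ℝ (Fin 3)), ContDiffOn ℝ (⊤ : ℕ∞)
      (Function.uncurry u) (Set.Iio 0 ×ˢ Set.univ) ∧ (∀ t < 0,
      Literature.Analysis.FluidPDE.VectorCalculus.IsDivFree (u t)) ∧ (∀ s t : ℝ, s < t → t < 0 → ∀
      x, u t x = Literature.Analysis.FluidPDE.heatFlow (u s) (t-s) x - ∫ τ in Set.Ioo s t, ∫ y,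
      ((-(inner ℝ (x-y) (u τ y) / (2*(t-τ)) * Literature.Analysis.UnboundedOperators.heatKernel
      (t-τ) (x-y))) • u τ y + (∫ σ in Set.Ioi (t-τ),
      Literature.Analysis.UnboundedOperators.heatKernel σ (x-y) / (4*σ^2)) • (inner ℝ (x-y) (u τ y)
      • u τ y + inner ℝ (u τ y) (u τ y) • (x-y) + inner ℝ (x-y) (u τ y) • u τ y) - ((∫ σ in Set.Ioi
      (t-τ), Literature.Analysis.UnboundedOperators.heatKernel σ (x-y) / (8*σ^3)) * (inner ℝ (x-y)
      (u τ y) * inner ℝ (x-y) (u τ y))) • (x-y))) ∧ Literature.Analysis.FluidPDE.HasTypeITimeDecay C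
      u ∧ (∀ (x₀ : EuclideanSpace ℝ (Fin 3)) (t₀ r : ℝ), t₀ ≤ 0 → 0 < r → (∀ t, t₀ - r^2 < t → t <
      t₀ → r⁻¹ * ∫ x in Metric.ball x₀ r, ‖u t x‖^2 ≤ C) ∧ r⁻¹ * ∫ t in Set.Ioo (t₀ - r^2) t₀, ∫ x
      in Metric.ball x₀ r, ‖fderiv ℝ (u t) x‖^2 ≤ C) → (∃ t : ℝ, t < 0 ∧ ∃ x : EuclideanSpace ℝ (Fin
      3), ¬ (∃ v w : EuclideanSpace ℝ (Fin 3), ‖v‖ = 1 ∧ ‖w‖ = 1 ∧ inner ℝ v w = 0 ∧ ∀ α β : ℝ, (-t)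
      * inner ℝ (fderiv ℝ (u t) x (α • v + β • w)) (α • v + β • w) ≤ (1 / 8 : ℝ) * (α^2 + β^2))) → ∃
      (u' : ℝ → EuclideanSpace ℝ (Fin 3) → EuclideanSpace ℝ (Fin 3)) (m t₀ : ℝ) (x₀ : EuclideanSpace
      ℝ (Fin 3)), t₀ < 0 ∧ (ContDiffOn ℝ (⊤ : ℕ∞) (Function.uncurry u') (Set.Iio 0 ×ˢ Set.univ) ∧ (∀
      t < 0, Literature.Analysis.FluidPDE.VectorCalculus.IsDivFree (u' t)) ∧ (∀ s t : ℝ, s < t → t <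
      0 → ∀ x, u' t x = Literature.Analysis.FluidPDE.heatFlow (u' s) (t-s) x - ∫ τ in Set.Ioo s t, ∫
      y, ((-(inner ℝ (x-y) (u' τ y) / (2*(t-τ)) * Literature.Analysis.UnboundedOperators.heatKernel
      (t-τ) (x-y))) • u' τ y + (∫ σ in Set.Ioi (t-τ),
      Literature.Analysis.UnboundedOperators.heatKernel σ (x-y) / (4*σ^2)) • (inner ℝ (x-y) (u' τ y)
      • u' τ y + inner ℝ (u' τ y) (u' τ y) • (x-y) + inner ℝ (x-y) (u' τ y) • u' τ y) - ((∫ σ in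
      Set.Ioi (t-τ), Literature.Analysis.UnboundedOperators.heatKernel σ (x-y) / (8*σ^3)) * (inner ℝ
      (x-y) (u' τ y) * inner ℝ (x-y) (u' τ y))) • (x-y))) ∧
      Literature.Analysis.FluidPDE.HasTypeITimeDecay C u' ∧ (∀ (x₀ : EuclideanSpace ℝ (Fin 3)) (t₀ r
      : ℝ), t₀ ≤ 0 → 0 < r → (∀ t, t₀ - r^2 < t → t < t₀ → r⁻¹ * ∫ x in Metric.ball x₀ r, ‖u' t x‖^2
      ≤ C) ∧ r⁻¹ * ∫ t in Set.Ioo (t₀ - r^2) t₀, ∫ x in Metric.ball x₀ r, ‖fderiv ℝ (u' t) x‖^2 ≤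
      C)) ∧ 1 / 8 ≤ m ∧ (∃ v w : EuclideanSpace ℝ (Fin 3), ‖v‖ = 1 ∧ ‖w‖ = 1 ∧ inner ℝ v w = 0 ∧ ∀ α
      β : ℝ, m * (α^2 + β^2) ≤ (-t₀) * inner ℝ (fderiv ℝ (u' t₀) x₀ (α • v + β • w)) (α • v + β •
      w)) ∧ (∀ v' : ℝ → EuclideanSpace ℝ (Fin 3) → EuclideanSpace ℝ (Fin 3), ContDiffOn ℝ (⊤ : ℕ∞)
      (Function.uncurry v') (Set.Iio 0 ×ˢ Set.univ) ∧ (∀ t < 0,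
      Literature.Analysis.FluidPDE.VectorCalculus.IsDivFree (v' t)) ∧ (∀ s t : ℝ, s < t → t < 0 → ∀
      x, v' t x = Literature.Analysis.FluidPDE.heatFlow (v' s) (t-s) x - ∫ τ in Set.Ioo s t, ∫ y,
      ((-(inner ℝ (x-y) (v' τ y) / (2*(t-τ)) * Literature.Analysis.UnboundedOperators.heatKernel
      (t-τ) (x-y))) • v' τ y + (∫ σ in Set.Ioi (t-τ),
      Literature.Analysis.UnboundedOperators.heatKernel σ (x-y) / (4*σ^2)) • (inner ℝ (x-y) (v' τ y)
      • v' τ y + inner ℝ (v' τ y) (v' τ y) • (x-y) + inner ℝ (x-y) (v' τ y) • v' τ y) - ((∫ σ in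
      Set.Ioi (t-τ), Literature.Analysis.UnboundedOperators.heatKernel σ (x-y) / (8*σ^3)) * (inner ℝ
      (x-y) (v' τ y) * inner ℝ (x-y) (v' τ y))) • (x-y))) ∧
      Literature.Analysis.FluidPDE.HasTypeITimeDecay C v' ∧ (∀ (x₀ : EuclideanSpace ℝ (Fin 3)) (t₀ r
      : ℝ), t₀ ≤ 0 → 0 < r → (∀ t, t₀ - r^2 < t → t < t₀ → r⁻¹ * ∫ x in Metric.ball x₀ r, ‖v' t x‖^2
      ≤ C) ∧ r⁻¹ * ∫ t in Set.Ioo (t₀ - r^2) t₀, ∫ x in Metric.ball x₀ r, ‖fderiv ℝ (v' t) x‖^2 ≤ C)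
      → ∀ t < 0, ∀ x, (∃ v w : EuclideanSpace ℝ (Fin 3), ‖v‖ = 1 ∧ ‖w‖ = 1 ∧ inner ℝ v w = 0 ∧ ∀ α β
      : ℝ, (-t) * inner ℝ (fderiv ℝ (v' t) x (α • v + β • w)) (α • v + β • w) ≤ m * (α^2 + β^2)))) →
    (∀ (C m : ℝ) (u : ℝ → EuclideanSpace ℝ (Fin 3) → EuclideanSpace ℝ (Fin 3)) (t₀ : ℝ) (x₀ :
      EuclideanSpace ℝ (Fin 3)), t₀ < 0 → (ContDiffOn ℝ (⊤ : ℕ∞) (Function.uncurry u) (Set.Iio 0 ×ˢ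
      Set.univ) ∧ (∀ t < 0, Literature.Analysis.FluidPDE.VectorCalculus.IsDivFree (u t)) ∧ (∀ s t :
      ℝ, s < t → t < 0 → ∀ x, u t x = Literature.Analysis.FluidPDE.heatFlow (u s) (t-s) x - ∫ τ in
      Set.Ioo s t, ∫ y, ((-(inner ℝ (x-y) (u τ y) / (2*(t-τ)) *
      Literature.Analysis.UnboundedOperators.heatKernel (t-τ) (x-y))) • u τ y + (∫ σ in Set.Ioi
      (t-τ), Literature.Analysis.UnboundedOperators.heatKernel σ (x-y) / (4*σ^2)) • (inner ℝ (x-y)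
      (u τ y) • u τ y + inner ℝ (u τ y) (u τ y) • (x-y) + inner ℝ (x-y) (u τ y) • u τ y) - ((∫ σ in
      Set.Ioi (t-τ), Literature.Analysis.UnboundedOperators.heatKernel σ (x-y) / (8*σ^3)) * (inner ℝ
      (x-y) (u τ y) * inner ℝ (x-y) (u τ y))) • (x-y))) ∧
      Literature.Analysis.FluidPDE.HasTypeITimeDecay C u ∧ (∀ (x₀ : EuclideanSpace ℝ (Fin 3)) (t₀ r
      : ℝ), t₀ ≤ 0 → 0 < r → (∀ t, t₀ - r^2 < t → t < t₀ → r⁻¹ * ∫ x in Metric.ball x₀ r, ‖u t x‖^2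
      ≤ C) ∧ r⁻¹ * ∫ t in Set.Ioo (t₀ - r^2) t₀, ∫ x in Metric.ball x₀ r, ‖fderiv ℝ (u t) x‖^2 ≤ C))
      → (∃ v w : EuclideanSpace ℝ (Fin 3), ‖v‖ = 1 ∧ ‖w‖ = 1 ∧ inner ℝ v w = 0 ∧ ∀ α β : ℝ, m * (α^2
      + β^2) ≤ (-t₀) * inner ℝ (fderiv ℝ (u t₀) x₀ (α • v + β • w)) (α • v + β • w)) → (∀ v' : ℝ →
      EuclideanSpace ℝ (Fin 3) → EuclideanSpace ℝ (Fin 3), ContDiffOn ℝ (⊤ : ℕ∞) (Function.uncurry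
      v') (Set.Iio 0 ×ˢ Set.univ) ∧ (∀ t < 0, Literature.Analysis.FluidPDE.VectorCalculus.IsDivFree
      (v' t)) ∧ (∀ s t : ℝ, s < t → t < 0 → ∀ x, v' t x = Literature.Analysis.FluidPDE.heatFlow (v'
      s) (t-s) x - ∫ τ in Set.Ioo s t, ∫ y, ((-(inner ℝ (x-y) (v' τ y) / (2*(t-τ)) *
      Literature.Analysis.UnboundedOperators.heatKernel (t-τ) (x-y))) • v' τ y + (∫ σ in Set.Ioi
      (t-τ), Literature.Analysis.UnboundedOperators.heatKernel σ (x-y) / (4*σ^2)) • (inner ℝ (x-y)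
      (v' τ y) • v' τ y + inner ℝ (v' τ y) (v' τ y) • (x-y) + inner ℝ (x-y) (v' τ y) • v' τ y) - ((∫
      σ in Set.Ioi (t-τ), Literature.Analysis.UnboundedOperators.heatKernel σ (x-y) / (8*σ^3)) *
      (inner ℝ (x-y) (v' τ y) * inner ℝ (x-y) (v' τ y))) • (x-y))) ∧
      Literature.Analysis.FluidPDE.HasTypeITimeDecay C v' ∧ (∀ (x₀ : EuclideanSpace ℝ (Fin 3)) (t₀ r
      : ℝ), t₀ ≤ 0 → 0 < r → (∀ t, t₀ - r^2 < t → t < t₀ → r⁻¹ * ∫ x in Metric.ball x₀ r, ‖v' t x‖^2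
      ≤ C) ∧ r⁻¹ * ∫ t in Set.Ioo (t₀ - r^2) t₀, ∫ x in Metric.ball x₀ r, ‖fderiv ℝ (v' t) x‖^2 ≤ C)
      → ∀ t < 0, ∀ x, (∃ v w : EuclideanSpace ℝ (Fin 3), ‖v‖ = 1 ∧ ‖w‖ = 1 ∧ inner ℝ v w = 0 ∧ ∀ α β
      : ℝ, (-t) * inner ℝ (fderiv ℝ (v' t) x (α • v + β • w)) (α • v + β • w) ≤ m * (α^2 + β^2))) →
      m < 1 / 8) →
    ((∀ (C : ℝ) (u : ℝ → EuclideanSpace ℝ (Fin 3) → EuclideanSpace ℝ (Fin 3)), ContDiffOn ℝ (⊤ :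
      ℕ∞) (Function.uncurry u) (Set.Iio 0 ×ˢ Set.univ) ∧ (∀ t < 0,
      Literature.Analysis.FluidPDE.VectorCalculus.IsDivFree (u t)) ∧ (∀ s t : ℝ, s < t → t < 0 → ∀
      x, u t x = Literature.Analysis.FluidPDE.heatFlow (u s) (t - s) x - ∫ τ in Set.Ioo s t, ∫ y,
      ((-(inner ℝ (x - y) (u τ y) / (2 * (t - τ)) *
      Literature.Analysis.UnboundedOperators.heatKernel (t - τ) (x - y))) • u τ y + (∫ σ in Set.Ioi
      (t - τ), Literature.Analysis.UnboundedOperators.heatKernel σ (x - y) / (4 * σ ^ 2)) • (inner ℝ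
      (x - y) (u τ y) • u τ y + inner ℝ (u τ y) (u τ y) • (x - y) + inner ℝ (x - y) (u τ y) • u τ y)
      - ((∫ σ in Set.Ioi (t - τ), Literature.Analysis.UnboundedOperators.heatKernel σ (x - y) / (8 *
      σ ^ 3)) * (inner ℝ (x - y) (u τ y) * inner ℝ (x - y) (u τ y))) • (x - y))) ∧
      Literature.Analysis.FluidPDE.HasTypeITimeDecay C u ∧ (∀ (x₀ : EuclideanSpace ℝ (Fin 3)) (t₀ r
      : ℝ), t₀ ≤ 0 → 0 < r → (∀ t, t₀ - r ^ 2 < t → t < t₀ → r⁻¹ * ∫ x in Metric.ball x₀ r, ‖u t x‖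
      ^ 2 ≤ C) ∧ r⁻¹ * ∫ t in Set.Ioo (t₀ - r ^ 2) t₀, ∫ x in Metric.ball x₀ r, ‖fderiv ℝ (u t) x‖ ^
      2 ≤ C) → ¬ (∀ r > 0, ∀ M : ℝ, ∃ t ∈ Set.Ioo (-(r ^ 2)) (0 : ℝ), ∃ x ∈ Metric.ball (0 :
      EuclideanSpace ℝ (Fin 3)) r, M < ‖u t x‖)) → ∀ (ν T : ℝ), 0 < ν → 0 < T → ∀ (u : ℝ →
      EuclideanSpace ℝ (Fin 3) → EuclideanSpace ℝ (Fin 3)) (p : ℝ → EuclideanSpace ℝ (Fin 3) → ℝ),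
      Literature.Analysis.FluidPDE.IsClassicalNSSolutionOn (Set.Ico 0 T) ν 0 u p →
      Literature.Analysis.FluidPDE.IsLerayHopfOn T ν 0 (u 0) u →
      Literature.Analysis.FluidPDE.HasRapidSpatialDecay (u 0) →
      Literature.Analysis.FluidPDE.IsTypeIBlowup u T →
      Literature.Analysis.FluidPDE.HasSmoothExtensionPast ν 0 u T) →
    (∀ (ν T : ℝ), 0 < ν → 0 < T → ∀ (u : ℝ → EuclideanSpace ℝ (Fin 3) → EuclideanSpace ℝ (Fin 3))
      (p : ℝ → EuclideanSpace ℝ (Fin 3) → ℝ), Literature.Analysis.FluidPDE.IsMaximalSmoothSolution ν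
      0 u p T → Literature.Analysis.FluidPDE.IsLerayHopfOn T ν 0 (u 0) u →
      Literature.Analysis.FluidPDE.HasRapidSpatialDecay (u 0) →
      Literature.Analysis.FluidPDE.IsTypeIBlowup u T) →
    ((∀ (ν T : ℝ), 0 < ν → 0 < T → ∀ (u : ℝ → EuclideanSpace ℝ (Fin 3) → EuclideanSpace ℝ (Fin 3))
      (p : ℝ → EuclideanSpace ℝ (Fin 3) → ℝ), Literature.Analysis.FluidPDE.IsClassicalNSSolutionOn
      (Set.Ico 0 T) ν 0 u p → Literature.Analysis.FluidPDE.IsLerayHopfOn T ν 0 (u 0) u →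
      Literature.Analysis.FluidPDE.HasRapidSpatialDecay (u 0) →
      Literature.Analysis.FluidPDE.HasSmoothExtensionPast ν 0 u T) → NavierStokesRegularity) →
    _root_.NavierStokesRegularity := by
  intro hM hE hX hZ hII hClay
  -- Step 1 (the card's dichotomy, pure logic): Liouville on the Type-I model class 𝒦_C
  -- (the body of the route's target `SqueezeLiouville`, verbatim).
  have hL :
      ∀ (C : ℝ) (u : ℝ → EuclideanSpace ℝ (Fin 3) → EuclideanSpace ℝ (Fin 3)), ContDiffOn ℝ (⊤ :
        ℕ∞) (Function.uncurry u) (Set.Iio 0 ×ˢ Set.univ) ∧ (∀ t < 0,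
        Literature.Analysis.FluidPDE.VectorCalculus.IsDivFree (u t)) ∧ (∀ s t : ℝ, s < t → t < 0 → ∀
        x, u t x = Literature.Analysis.FluidPDE.heatFlow (u s) (t-s) x - ∫ τ in Set.Ioo s t, ∫ y,
        ((-(inner ℝ (x-y) (u τ y) / (2*(t-τ)) * Literature.Analysis.UnboundedOperators.heatKernel
        (t-τ) (x-y))) • u τ y + (∫ σ in Set.Ioi (t-τ),
        Literature.Analysis.UnboundedOperators.heatKernel σ (x-y) / (4*σ^2)) • (inner ℝ (x-y) (u τ
        y) • u τ y + inner ℝ (u τ y) (u τ y) • (x-y) + inner ℝ (x-y) (u τ y) • u τ y) - ((∫ σ in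
        Set.Ioi (t-τ), Literature.Analysis.UnboundedOperators.heatKernel σ (x-y) / (8*σ^3)) * (inner
        ℝ (x-y) (u τ y) * inner ℝ (x-y) (u τ y))) • (x-y))) ∧
        Literature.Analysis.FluidPDE.HasTypeITimeDecay C u ∧ (∀ (x₀ : EuclideanSpace ℝ (Fin 3)) (t₀
        r : ℝ), t₀ ≤ 0 → 0 < r → (∀ t, t₀ - r^2 < t → t < t₀ → r⁻¹ * ∫ x in Metric.ball x₀ r, ‖u t
        x‖^2 ≤ C) ∧ r⁻¹ * ∫ t in Set.Ioo (t₀ - r^2) t₀, ∫ x in Metric.ball x₀ r, ‖fderiv ℝ (u t)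
        x‖^2 ≤ C) → ∀ t < 0, ∀ x, u t x = 0 := by
    intro C u hu
    by_cases h : ∀ t < 0, ∀ x, (∃ v w : EuclideanSpace ℝ (Fin 3), ‖v‖ = 1 ∧ ‖w‖ = 1 ∧ inner ℝ v w = 0 ∧ ∀ α β : ℝ, (-t) * inner ℝ (fderiv ℝ (u t) x (α • v + β • w)) (α • v + β • w) ≤ (1 / 8 : ℝ) * (α^2 + β^2))
    · exact hM C u hu h
    · have h' : ∃ t : ℝ, t < 0 ∧ ∃ x : EuclideanSpace ℝ (Fin 3), ¬ (∃ v w : EuclideanSpace ℝ (Fin 3), ‖v‖ = 1 ∧ ‖w‖ = 1 ∧ inner ℝ v w = 0 ∧ ∀ α β : ℝ, (-t) * inner ℝ (fderiv ℝ (u t) x (α • v + β • w)) (α • v + β • w) ≤ (1 / 8 : ℝ) * (α^2 + β^2)) := by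
        by_contra hcon
        apply h
        intro t ht x
        by_contra hx
        exact hcon ⟨t, ht, x, hx⟩
      obtain ⟨u', m, t₀, x₀, ht₀, hu', hm, hGE, hmax⟩ := hE C u hu h'
      have hlt : m < 1 / 8 := hX C m u' t₀ x₀ ht₀ hu' hGE hmax
      exact absurd hm (not_le.mpr hlt)
  -- Step 2 (known tail shared with route ClockStretchingLaw): no singular Type-I model, zoom,
  -- Type-I rate, Clay (A).
  apply hClay
  intro ν T hν hT u p hcl hLH hdec
  by_contra hext
  have hTI : Literature.Analysis.FluidPDE.IsTypeIBlowup u T :=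
    hII ν T hν hT u p ⟨hcl, hext⟩ hLH hdec
  refine hext (hZ ?_ ν T hν hT u p hcl hLH hdec hTI)
  intro C v hv hsing
  obtain ⟨t, ht, x, _hx, hlt⟩ := hsing 1 one_pos 0
  have h0 : v t x = 0 := hL C v hv t ht.2 x
  rw [h0, norm_zero] at hlt
  exact lt_irrefl _ hlt

end Summit.NavierStokesRegularity.NavierStokesRegularity.Theorems
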